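import Literature.MathematicalPhysics.QuantumFieldTheory.Balaban1983to89.B9Eq365QGGQLowerVariationalWindow

/-!
# `Balaban1983to89.B9Eq365QGGQLowerVariationalWindowUniform` — T. Bałaban, *Propagators for lattice gauge theories in a background field*, Commun.
# Math. Phys. **99** (1985) 389–434 [Balaban1985BackgroundPropagators] Thm 3.11 p. 416 with (3.16) p. 393, (3.24)–(3.25) p. 394, (3.35) p. 396, and
# [Balaban1984PropagatorsII] (2.74)–(2.77) p. 236: **THE ONE-SHOT THIRD OPERATOR `Q̃′G′(U)²Q̃′(U)†` ON PRINT's DIAGONAL `ηL = 1`, `c₀L^d = c₁` AT THE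
# SCALED EDGE `‖U(b) − 1‖ ≤ αη` IS BOUNDED BELOW BY ONE NUMBER `κ₀(d, a′, 2M_φM_φ′)` FOR EVERY BLOCK RATIO `L ≥ 3`, AND `∃ α₁ κ > 0` STANDS BEFORE `∀ L`** —
# the `∃`-first COROLLARY of ne9-leaf-01's `B9Eq365QGGQLowerVariationalWindow.qggq_coercive_window` by t4-ne9-idea-1 g116's two monotonicity remarks
# (memo `KEEPKILL-ANSWER-g116.md` §E (E.2), booked P-R2′-g116-E2; the pub-balaban NE9 refuter desk's KAPPA1, one-shot half «untyped as `∃`-first»), with the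
# pure-real diagonal floor shared with the tower sequel `B9Eq365QGGQLowerVariationalWindowTowerDiagonal`

statement-level skeleton of published theorems with citation tags; proofs where landed; nothing here is a claim about the Yang–Mills mass gap

CITATION HEADER (lean-in-tree rule).  Audit cell `pub-balaban`, sub-cell `t4`, BINDER row NE9; filed by NE9 crux-team LEAF PROVER 03
(`b2b-balaban-t4-ne9-formalise-leaf-03`, gen 73).  LOCUS: t4-ne9-idea-1 g116 memo §E (E.2) «κ_W(L, α) ≥ κ_one-shot(d, a′, K, α) for EVERY block ratio L ≥ 3
… by two monotonicity remarks (m(L) ≥ 1∕27, m^d ≤ 6^{−d}, ρ ≤ ρ∞) … `∃ α₁ κ > 0, ∀ L ≥ 3, …` untyped» (journal l.55469); refuter desk KEEP∕KILL draft v4 (gen 48) §3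
(«its covariant ONE-SHOT half has a closed form per block ratio … n-free BY COROLLARY in print's scaled currency … untyped as `∃`-first, P-R2′-g116-E2»).
Composed BY NAME from ne9-leaf-01's `qggq_coercive_window` (gen 78); the arithmetic is this seat's.  Sources READ in the held text
(`paper:balaban1985-cmp99-background-propagators`, journal page = PDF page + 388): p. 393 (3.16), p. 394 (3.24)–(3.25), p. 396 (3.35), p. 416 Thm 3.11.

THE PRINT (verbatim).  [B9] p. 416 Thm 3.11: *«the operators Δ′_a, G′, (Q′G′²Q′*)⁻¹, Δ_a, G are positive definite … uniformly bounded»*; p. 396 (3.35):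
*«|U(b) − 1| < α₀η»* (the scaled small-field edge); [B6] p. 236: the lower bound of `Q′G′Q′*` by *«a positive, absolute constant»* (2.74)–(2.77).  NOTHING
of print's constants is asserted; the floor is the cell's crude variational one, its SIZE is not print's — what is delivered is the QUANTIFIER ORDER.

WHAT IS PROVED (sorry-free; proof lane — 0 `def`; [folklore] real arithmetic on a landed closed form).
* §1 **`qggq_constant_scaled_ge`** — THE ARITHMETIC (pure reals; serves this file at `N = L` and the tower sequel at `N = L^{n+1}`): with
  `β = ((N−1)(N−2)∕6)^d`, `B = (N²∕4)^d`, `3 ≤ N`, readings `x = N` (`= |η⁻¹|`), `w = 1` (`= c₀N^d∕c₁`), scaled edge `x·e ≤ Kα`, `0 ≤ α ≤ 1`, window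
  `ρB ≤ β∕2`: leaf-01's closed form `((β∕2)²∕M)²·w∕(1+ρ)²` is `≥ κ₀ := 1∕(36Λ²)`, `Λ = (32d + 2dK²)(729∕16)^d + 9a′∕4` (`β ≥ (N²∕27)^d` with EQUALITY at
  `N = 3`; `N²(N(N²∕4)^{d−1})²d = 16d(729∕16)^d((N²∕27)^d)²`; `B² = (729∕16)^d((N²∕27)^d)²`; `(Ne)² ≤ K²`; `(β + ρB)² ≤ (9∕4)β²`; `1 + ρ ≤ 3∕2`).
* §2 **`qggq_coercive_window_scaled`** — for `3 ≤ L`, `ηL = 1`, `c₀L^d = c₁`, `‖U(b) − 1‖ ≤ αη` in `U1`, `hRS`, `hpos′`, `0 ≤ α ≤ 1` and the `L`-FREE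
  window `exp(dKα) − 1 ≤ (4∕27)^d∕2` (`ρ′ = (1 + Kα∕L)^{d(L−1)} − 1 ≤ exp(dKα) − 1`): `κ₀·‖ψ‖² ≤ re⟪ψ, Q̃′(U)G′(U)²Q̃′(U)†ψ⟫` — leaf-06's
  `B9Eq325ProjFormula.QGGQ_pos` operator VERBATIM — the SAME `κ₀` at every block ratio `L ≥ 3`, period `m`, `η` on the diagonal.
* §3 **`exists_qggq_coercive_window_scaled`** — `∃ α₁ κ > 0` (closed forms in `(d, a′, K)`: `α₁ = min 1 ((4∕27)^d∕(4(dK+1)))`, `κ = κ₀`) BEFORE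
  `∀ L ≥ 3, ∀ η (ηL = 1), c₀, c₁ (c₀L^d = c₁), m, U, α ≤ α₁, hpos′, ψ`: `κ‖ψ‖² ≤ re⟪ψ, Q̃′G′(U)²Q̃′†ψ⟫` — P-R2′-g116-E2 typed.
HONEST SCOPE.  Packaging + threshold arithmetic; `κ₀` (d = 4, a′ = 1, K = 2: 5.8·10⁻²⁰) is BELOW g116's floated `κ_one-shot = 2.05·10⁻¹⁹` by three extra
crude steps — the size is the degenerate tent's at `L = 3`, NOT the operator's and NOT print's; `hRS`, `U ∈ U1` and the edge are DISPLAYED (print's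
(3.35)); `hpos′` is quantified (inhabited level-free by this lineage's `B9Thm311SitePrimeFormCoerciveCanonical`); `L²` floor only — NOT the kernel decay of
`(Q̃′G′²Q̃′†)⁻¹`, NOT NE9, NOT the route (cell pub-balaban: NE9 NOT PRINTED ∕ NOT PROVED; «NE9 ⇐ the named binders»; row WALLED ON A MODEL (O-NE9-1; #5
UNRULED); spine PROVED 0∕9; rung (B)+1 on a finite T⁴ — NOT infinite volume, NOT mass gap, NOT BetaPertH, NOT Clay; HONEST DEPENDENCY: continuum YM on T⁴ ⇐
BetaPertH ∧ nine spine estimates (0/9 proved); BetaPertH ⇐ (D1) ∧ (D4) ∧ CAP+tail; G-an2-4 gates asym, D1 and NE2/3/4).  NEW file importing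
`B9Eq365QGGQLowerVariationalWindow` (built); nothing modified.  Net new unproved facts: 0.
-/

noncomputable section

open scoped InnerProductSpace ComplexConjugate BigOperators

namespace Literature.MathematicalPhysics.QuantumFieldTheory.Balaban1983to89.B9Eq365QGGQLowerVariationalWindowUniform

open B4Sect5Torus (TSite)
open B9SectCLatticeCarrier (Bond)
open B7Prop1Explicit (U1)
open B9Eq311L2Pairing (WL2)
open B9Eq319QprimeTorus (fineP)
open B11Eq103H1Complex (SiteL2K)
open B9Eq310HessianOperator (adTransportW)
open B9Eq326OperatorAssembly (QprimeW)
open B9Eq3119DeltaPiCarrier (laplacePrimeA GpOfU)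
open B9Eq365QGGQLowerVariationalWindow (qggq_coercive_window)

/-! ## §1 The arithmetic of the diagonal floor (pure reals) -/

section Arith

/-- `exp y − 1 ≤ 2y` on `0 ≤ y ≤ 1` (private arithmetic helper). [folklore] -/
private theorem exp_sub_one_le_two_mul {y : ℝ} (hy0 : 0 ≤ y) (hy1 : y ≤ 1) : Real.exp y - 1 ≤ 2 * y := by
  have h := Real.abs_exp_sub_one_sub_id_le (x := y) (by rw [abs_of_nonneg hy0]; exact hy1)
  have h' : Real.exp y - 1 - y ≤ y ^ 2 := (le_abs_self _).trans h
  nlinarith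

/-- **THE ARITHMETIC OF THE DIAGONAL FLOOR**: with `β = ((N−1)(N−2)∕6)^d`, `B = (N²∕4)^d` at `3 ≤ N`, the readings `x = N` (`= |η⁻¹|`), `w = 1`
(`= c₀N^d∕c₁`), `x·e ≤ Kα` (the scaled edge), `0 ≤ α ≤ 1` and the window `ρB ≤ β∕2`: the closed form of `qggq_coercive_window` (block ratio `N`) is
`≥ 1∕(36Λ²)`, `Λ = (32d + 2dK²)(729∕16)^d + 9a′∕4` — `β ≥ (N²∕27)^d`, `N²(N(N²∕4)^{d−1})²d = 16d(729∕16)^dβ♭²`, `B² = (729∕16)^dβ♭²` (`β♭ = (N²∕27)^d ≤ β`),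
`(β + ρB)² ≤ (9∕4)β²`, `1 + ρ ≤ 3∕2`: every power of `N` cancels. [folklore] [cite: Balaban1985BackgroundPropagators, Thm 3.11 p.416, (3.16) p.393, (3.35) p.396] -/
theorem qggq_constant_scaled_ge {d : ℕ} {N x e w K α a' ρ : ℝ} (hN : 3 ≤ N) (ha' : 0 < a') (hK : 0 ≤ K) (hα0 : 0 ≤ α)
    (hα1 : α ≤ 1) (he0 : 0 ≤ e) (hx : x = N) (hw : w = 1) (he : x * e ≤ K * α) (hρ0 : 0 ≤ ρ)
    (hwin : ρ * (N ^ 2 / 4) ^ d ≤ ((N - 1) * (N - 2) / 6) ^ d / 2) :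
    1 / (36 * ((32 * (d : ℝ) + 2 * (d : ℝ) * K ^ 2) * (729 / 16) ^ d + 9 * a' / 4) ^ 2) ≤
      ((((N - 1) * (N - 2) / 6) ^ d / 2) ^ 2 /
          (2 * (x ^ 2 * (N * (N ^ 2 / 4) ^ (d - 1)) ^ 2 * (d : ℝ) * w) + 2 * (x ^ 2 * e ^ 2 * (d : ℝ) * ((N ^ 2 / 4) ^ d) ^ 2 * w) +
            a' * (((N - 1) * (N - 2) / 6) ^ d + ρ * (N ^ 2 / 4) ^ d) ^ 2)) ^ 2 * w / (1 + ρ) ^ 2 := by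
  subst x
  rw [hw]
  set β : ℝ := ((N - 1) * (N - 2) / 6) ^ d with hβ
  set Bs : ℝ := (N ^ 2 / 4) ^ d with hBs
  set Λ : ℝ := (32 * (d : ℝ) + 2 * (d : ℝ) * K ^ 2) * (729 / 16) ^ d + 9 * a' / 4 with hΛ
  set Mx : ℝ := 2 * (N ^ 2 * (N * (N ^ 2 / 4) ^ (d - 1)) ^ 2 * (d : ℝ) * 1) + 2 * (N ^ 2 * e ^ 2 * (d : ℝ) * Bs ^ 2 * 1) +
    a' * (β + ρ * Bs) ^ 2 with hMx
  have hN0 : 0 < N := by linarith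
  have hN1 : 0 < N - 1 := by linarith
  have hN2 : 0 < N - 2 := by linarith
  have hprof : N ^ 2 / 27 ≤ (N - 1) * (N - 2) / 6 := by
    nlinarith [mul_nonneg (sub_nonneg.2 hN) (by linarith : (0 : ℝ) ≤ 21 * N - 18)]
  have hβ0 : 0 < β := by rw [hβ]; positivity
  have hBs0 : 0 < Bs := by rw [hBs]; positivity
  have hΛ0 : 0 < Λ := by rw [hΛ]; positivity
  have hMx0 : 0 < Mx := by rw [hMx]; positivity
  -- `β♭ := (N²∕27)^d ≤ β ≤ B`
  have hβge : (N ^ 2 / 27) ^ d ≤ β := by rw [hβ]; exact pow_le_pow_left₀ (by positivity) hprof d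
  have hβle : β ≤ Bs := by
    rw [hβ, hBs]; exact pow_le_pow_left₀ (by positivity) (by nlinarith [sq_nonneg N, hN]) d
  have hβsq : ((N ^ 2 / 27) ^ d) ^ 2 ≤ β ^ 2 := pow_le_pow_left₀ (by positivity) hβge 2
  -- `ρ ≤ 1∕2`
  have hρle : ρ ≤ 1 / 2 := le_of_mul_le_mul_right (by linarith [hwin] : ρ * Bs ≤ 1 / 2 * Bs) hBs0
  -- the identities `N²(N(N²∕4)^k)² = 16(729∕16)^{k+1} β♭_{k+1}²`, `B² = (729∕16)^d β♭²`
  have e4 : ∀ k : ℕ, N ^ 2 * (N * (N ^ 2 / 4) ^ k) ^ 2 = 16 * (729 / 16) ^ (k + 1) * ((N ^ 2 / 27) ^ (k + 1)) ^ 2 := by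
    intro k
    induction k with
    | zero => ring
    | succ k ih =>
      have hs : N ^ 2 * (N * (N ^ 2 / 4) ^ (k + 1)) ^ 2 = (N ^ 2 * (N * (N ^ 2 / 4) ^ k) ^ 2) * ((N ^ 2 / 4) ^ 2) := by ring
      rw [hs, ih, pow_succ ((729 : ℝ) / 16) (k + 1), pow_succ (N ^ 2 / 27) (k + 1)]
      ring
  have eB : ∀ k : ℕ, ((N ^ 2 / 4) ^ k) ^ 2 = (729 / 16) ^ k * ((N ^ 2 / 27) ^ k) ^ 2 := fun k => by
    rw [← pow_mul, ← pow_mul, mul_comm k 2, pow_mul, pow_mul, ← mul_pow]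
    congr 1
    ring
  -- the `E`-term
  have hE : N ^ 2 * (N * (N ^ 2 / 4) ^ (d - 1)) ^ 2 * (d : ℝ) ≤ 16 * (d : ℝ) * (729 / 16) ^ d * β ^ 2 := by
    rcases Nat.eq_zero_or_pos d with hd | hd
    · subst hd; simp
    · obtain ⟨k, rfl⟩ : ∃ k, d = k + 1 := ⟨d - 1, (Nat.sub_add_cancel hd).symm⟩
      rw [Nat.add_sub_cancel, e4 k]
      have h0 : (0 : ℝ) ≤ ((k + 1 : ℕ) : ℝ) := Nat.cast_nonneg _
      calc 16 * (729 / 16) ^ (k + 1) * ((N ^ 2 / 27) ^ (k + 1)) ^ 2 * ((k + 1 : ℕ) : ℝ)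
          ≤ 16 * (729 / 16) ^ (k + 1) * β ^ 2 * ((k + 1 : ℕ) : ℝ) := by gcongr
        _ = 16 * ((k + 1 : ℕ) : ℝ) * (729 / 16) ^ (k + 1) * β ^ 2 := by ring
  -- the `E′`-term: `(Ne)² ≤ (Kα)² ≤ K²`
  have hNe : (N * e) ^ 2 ≤ K ^ 2 := by
    have h2 : K * α ≤ K := mul_le_of_le_one_right hK hα1
    exact (pow_le_pow_left₀ (by positivity) he 2).trans (pow_le_pow_left₀ (by positivity) h2 2)
  have hE' : N ^ 2 * e ^ 2 * (d : ℝ) * Bs ^ 2 ≤ (d : ℝ) * K ^ 2 * (729 / 16) ^ d * β ^ 2 := by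
    rw [show N ^ 2 * e ^ 2 = (N * e) ^ 2 by ring, hBs, eB d]
    calc (N * e) ^ 2 * (d : ℝ) * ((729 / 16) ^ d * ((N ^ 2 / 27) ^ d) ^ 2)
        ≤ K ^ 2 * (d : ℝ) * ((729 / 16) ^ d * β ^ 2) := by gcongr
      _ = (d : ℝ) * K ^ 2 * (729 / 16) ^ d * β ^ 2 := by ring
  -- the penalty term
  have hpen : (β + ρ * Bs) ^ 2 ≤ 9 / 4 * β ^ 2 := by
    have h1 : β + ρ * Bs ≤ 3 / 2 * β := by linarith [hwin]
    have h0 : 0 ≤ β + ρ * Bs := by positivity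
    calc (β + ρ * Bs) ^ 2 ≤ (3 / 2 * β) ^ 2 := pow_le_pow_left₀ h0 h1 2
      _ = 9 / 4 * β ^ 2 := by ring
  -- `M ≤ Λβ²`, `(β∕2)²∕M ≥ 1∕(4Λ)`, `(1+ρ)² ≤ 9∕4`
  have hM : Mx ≤ Λ * β ^ 2 := by
    rw [hMx, hΛ, mul_one, mul_one]; linarith [hE, hE', mul_le_mul_of_nonneg_left hpen ha'.le]
  have hk1 : 1 / (4 * Λ) ≤ (β / 2) ^ 2 / Mx := by
    rw [div_le_div_iff₀ (by positivity) hMx0]; linarith [hM]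
  have hk2 : (1 / (4 * Λ)) ^ 2 ≤ ((β / 2) ^ 2 / Mx) ^ 2 := pow_le_pow_left₀ (by positivity) hk1 2
  have hρ2 : (1 + ρ) ^ 2 ≤ 9 / 4 :=
    calc (1 + ρ) ^ 2 ≤ (3 / 2) ^ 2 := pow_le_pow_left₀ (by linarith) (by linarith) 2
      _ = 9 / 4 := by norm_num
  have hρ1 : 0 < (1 + ρ) ^ 2 := by positivity
  calc 1 / (36 * Λ ^ 2) = (1 / (4 * Λ)) ^ 2 / (9 / 4) := by field_simp; ring
    _ ≤ ((β / 2) ^ 2 / Mx) ^ 2 / (1 + ρ) ^ 2 := div_le_div₀ (by positivity) hk2 hρ1 hρ2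
    _ = ((β / 2) ^ 2 / Mx) ^ 2 * 1 / (1 + ρ) ^ 2 := by rw [mul_one]

/-- `β∕B ≥ (4∕27)^d` at `3 ≤ N`: the window letter `ρ ≤ (4∕27)^d∕2` implies the closed-form window `ρ·(N²∕4)^d ≤ ((N−1)(N−2)∕6)^d∕2`. [folklore]
[cite: Balaban1985BackgroundPropagators, (3.16) p.393; Balaban1984PropagatorsII, (2.74)–(2.77) p.236] -/
theorem window_of_ratio {d : ℕ} {N ρ : ℝ} (hN : 3 ≤ N) (hρ : ρ ≤ (4 / 27 : ℝ) ^ d / 2) :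
    ρ * (N ^ 2 / 4) ^ d ≤ ((N - 1) * (N - 2) / 6) ^ d / 2 := by
  have h1 : (4 / 27 : ℝ) ^ d * (N ^ 2 / 4) ^ d ≤ ((N - 1) * (N - 2) / 6) ^ d := by
    rw [← mul_pow]
    exact pow_le_pow_left₀ (by positivity) (by nlinarith [mul_nonneg (sub_nonneg.2 hN) (by linarith : (0 : ℝ) ≤ 21 * N - 18)]) d
  have h0 : 0 ≤ (N ^ 2 / 4) ^ d := by positivity
  calc ρ * (N ^ 2 / 4) ^ d ≤ (4 / 27 : ℝ) ^ d / 2 * (N ^ 2 / 4) ^ d := mul_le_mul_of_nonneg_right hρ h0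
    _ = (4 / 27 : ℝ) ^ d * (N ^ 2 / 4) ^ d / 2 := by ring
    _ ≤ _ := by linarith

end Arith

/-! ## §2 The one-shot third operator on print's diagonal at the scaled edge: one constant for every block ratio -/

section Scaled

variable {d : ℕ} (L : ℕ) [NeZero L] (m : Fin d → ℕ) [∀ i, NeZero (fineP L m i)]
  {𝔸 : Type*} [NormedRing 𝔸] [NormedAlgebra ℂ 𝔸] [NormOneClass 𝔸] {W : Type*} [NormedAddCommGroup W] [InnerProductSpace ℂ W]
  [FiniteDimensional ℂ W] (φ : W ≃ₗ[ℂ] 𝔸) (c₀ : ℝ) [Fact (0 < c₀)] (η : ℝ) (c₁ : ℝ) [Fact (0 < c₁)]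

/-- **THE ONE-SHOT THIRD OPERATOR ON THE DIAGONAL AT THE SCALED EDGE — ONE CONSTANT `κ₀(d, a′, K)` FOR EVERY BLOCK RATIO**: for `3 ≤ L`, `ηL = 1`,
`c₀L^d = c₁`, a background with `U(b) ∈ U1`, `‖U(b) − 1‖ ≤ αη` ((3.35)), mutually adjoint transporters, the displayed positivity `hpos′` of `Δ′_{a′}(U)`,
`0 ≤ α ≤ 1` and the `L`-FREE window `exp(dKα) − 1 ≤ (4∕27)^d∕2` (`K = 2M_φM_φ′`; `ρ′ = (1 + Kαη)^{d(L−1)} − 1 ≤ exp(dKα) − 1` since `ηL = 1`):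
`κ₀·‖ψ‖² ≤ re⟪ψ, Q̃′(U)G′(U)²Q̃′(U)†ψ⟫` — `B9Eq325ProjFormula.QGGQ_pos`'s operator VERBATIM — `κ₀ = 1∕(36Λ²)`, `Λ = (32d + 2dK²)(729∕16)^d + 9a′∕4`:
NO `L`, NO `η`, NO `m`, NO weights (leaf-01's `qggq_coercive_window` at `ε := αη` + §1).
[cite: Balaban1985BackgroundPropagators, Thm 3.11 p.416, (3.24)–(3.25) p.394, (3.16) p.393, (3.35) p.396; Balaban1984PropagatorsII, (2.74)–(2.77) p.236] -/
theorem qggq_coercive_window_scaled (hL3 : 3 ≤ L) {a' : ℝ} (ha' : 0 < a') {Mφ Mφ' : ℝ} (hMφ : 0 ≤ Mφ) (hMφ' : 0 ≤ Mφ')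
    (hφ : ∀ w, ‖φ w‖ ≤ Mφ * ‖w‖) (hφ' : ∀ X, ‖φ.symm X‖ ≤ Mφ' * ‖X‖)
    (U : Bond d (fineP L m) → 𝔸ˣ) (hU : ∀ b, U b ∈ U1 𝔸) {α : ℝ} (hα0 : 0 ≤ α) (hα1 : α ≤ 1) (hUε : ∀ b, ‖(U b : 𝔸) - 1‖ ≤ α * η)
    (hRS : ∀ (b : Bond d (fineP L m)) (v u : W), ⟪adTransportW φ U b v, u⟫_ℂ = ⟪v, adTransportW φ (fun b => (U b)⁻¹) b u⟫_ℂ)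
    (hpos' : ∀ x : SiteL2K ℂ d (fineP L m) c₀ W, x ≠ 0 → 0 < RCLike.re ⟪x, laplacePrimeA L m φ η U a' (c₁ := c₁) x⟫_ℂ)
    (hηL : η * (L : ℝ) = 1) (hw : c₀ * (L : ℝ) ^ d = c₁)
    (hwin : Real.exp ((d : ℝ) * (2 * Mφ * Mφ') * α) - 1 ≤ (4 / 27 : ℝ) ^ d / 2) (ψ : SiteL2K ℂ d m c₁ W) :
    1 / (36 * ((32 * (d : ℝ) + 2 * (d : ℝ) * (2 * Mφ * Mφ') ^ 2) * (729 / 16) ^ d + 9 * a' / 4) ^ 2) * ‖ψ‖ ^ 2 ≤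
      RCLike.re ⟪ψ, (((WL2.linearEquiv ℂ ℂ (fun _ : TSite d m => c₁)).symm.toLinearMap ∘ₗ QprimeW L m φ U (c₀ := c₀)) ∘ₗ
        GpOfU L m φ η U a' (c₁ := c₁) hpos' ∘ₗ GpOfU L m φ η U a' (c₁ := c₁) hpos' ∘ₗ
        LinearMap.adjoint ((WL2.linearEquiv ℂ ℂ (fun _ : TSite d m => c₁)).symm.toLinearMap ∘ₗ QprimeW L m φ U (c₀ := c₀))) ψ⟫_ℂ := by
  have hc₁ : 0 < c₁ := Fact.out
  have hL1 : (3 : ℝ) ≤ L := by exact_mod_cast hL3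
  have hL0 : (0 : ℝ) < L := by linarith
  have hη0 : 0 < η := pos_of_mul_pos_left (by rw [hηL]; exact one_pos) hL0.le
  have hK0 : 0 ≤ 2 * Mφ * Mφ' := by positivity
  set ρ' : ℝ := (1 + 2 * Mφ * Mφ' * (α * η)) ^ (d * (L - 1)) - 1 with hρ'
  have hρ0 : 0 ≤ ρ' := by rw [hρ']; exact sub_nonneg.2 (one_le_pow₀ (by nlinarith [mul_nonneg hK0 (mul_nonneg hα0 hη0.le)]))
  -- `ρ′ ≤ exp(dKα) − 1`: `(1 + Kαη)^{d(L−1)} ≤ exp(d(L−1)·Kαη) ≤ exp(dL·Kαη) = exp(dKα)` by `ηL = 1`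
  have hρle : ρ' ≤ (4 / 27 : ℝ) ^ d / 2 := by
    have hp : ((d * (L - 1) : ℕ) : ℝ) ≤ (d : ℝ) * L := by
      have h : d * (L - 1) ≤ d * L := Nat.mul_le_mul_left d (Nat.sub_le L 1)
      exact_mod_cast h
    have hx0 : 0 ≤ 2 * Mφ * Mφ' * (α * η) := by positivity
    have h1 : (1 + 2 * Mφ * Mφ' * (α * η)) ^ (d * (L - 1)) ≤ Real.exp (((d * (L - 1) : ℕ) : ℝ) * (2 * Mφ * Mφ' * (α * η))) := by
      rw [Real.exp_nat_mul]
      exact pow_le_pow_left₀ (by positivity) (by linarith [Real.add_one_le_exp (2 * Mφ * Mφ' * (α * η))]) _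
    have h2 : ((d * (L - 1) : ℕ) : ℝ) * (2 * Mφ * Mφ' * (α * η)) ≤ (d : ℝ) * (2 * Mφ * Mφ') * α :=
      calc ((d * (L - 1) : ℕ) : ℝ) * (2 * Mφ * Mφ' * (α * η)) ≤ (d : ℝ) * L * (2 * Mφ * Mφ' * (α * η)) :=
            mul_le_mul_of_nonneg_right hp hx0
        _ = (d : ℝ) * (2 * Mφ * Mφ') * α * (η * L) := by ring
        _ = (d : ℝ) * (2 * Mφ * Mφ') * α := by rw [hηL, mul_one]
    rw [hρ']
    linarith [h1.trans (Real.exp_le_exp.2 h2)]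
  have hwin' : ρ' * ((L : ℝ) ^ 2 / 4) ^ d ≤ (((L : ℝ) - 1) * ((L : ℝ) - 2) / 6) ^ d / 2 := window_of_ratio hL1 hρle
  have key := qggq_coercive_window L m φ c₀ η c₁ hL3 ha' hMφ hMφ' hφ hφ' U hU (ε := α * η) (by positivity) hUε hRS hpos' hwin' ψ
  -- the diagonal readings `|η⁻¹| = L`, `c₀L^d∕c₁ = 1`, `|η⁻¹|·Kαη = Kα`
  have hηinv : ‖((η : ℂ))⁻¹‖ = (L : ℝ) := by
    rw [norm_inv, Complex.norm_real, Real.norm_eq_abs, abs_of_pos hη0,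
      show η = ((L : ℝ))⁻¹ by rw [← one_div]; field_simp; linarith [hηL], inv_inv]
  have hρw1 : c₀ * (L : ℝ) ^ d / c₁ = 1 := by rw [hw, div_self hc₁.ne']
  have he : ‖((η : ℂ))⁻¹‖ * (2 * Mφ * Mφ' * (α * η)) ≤ 2 * Mφ * Mφ' * α := by
    rw [hηinv, show (L : ℝ) * (2 * Mφ * Mφ' * (α * η)) = 2 * Mφ * Mφ' * α * (η * (L : ℝ)) by ring, hηL, mul_one]
  have hfloor := qggq_constant_scaled_ge (d := d) hL1 ha' hK0 hα0 hα1 (by positivity : 0 ≤ 2 * Mφ * Mφ' * (α * η)) hηinv hρw1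
    he hρ0 hwin'
  exact le_trans (mul_le_mul_of_nonneg_right hfloor (sq_nonneg _)) key

end Scaled

/-! ## §3 KAPPA1, one-shot half, `∃`-first: `∃ α₁ κ > 0` before every block ratio -/

section Exists

variable {d : ℕ} {𝔸 : Type*} [NormedRing 𝔸] [NormedAlgebra ℂ 𝔸] [NormOneClass 𝔸] {W : Type*} [NormedAddCommGroup W] [InnerProductSpace ℂ W]
  [FiniteDimensional ℂ W] (φ : W ≃ₗ[ℂ] 𝔸) {a' Mφ Mφ' : ℝ} (ha' : 0 < a') (hMφ : 0 ≤ Mφ) (hMφ' : 0 ≤ Mφ')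
  (hφ : ∀ w, ‖φ w‖ ≤ Mφ * ‖w‖) (hφ' : ∀ X, ‖φ.symm X‖ ≤ Mφ' * ‖X‖)

include ha' hMφ hMφ' hφ hφ' in
/-- **KAPPA1, ONE-SHOT HALF (P-R2′-g116-E2 TYPED) — `∃ α₁ κ > 0` BEFORE EVERY BLOCK RATIO, LATTICE AND BACKGROUND**: there are `α₁, κ > 0` (closed
forms in `(d, a′, K = 2M_φM_φ′)`: `α₁ = min 1 ((4∕27)^d∕(4(dK+1)))`, `κ = κ₀` of `qggq_coercive_window_scaled`) such that for every block ratio `L ≥ 3`,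
`η` on the diagonal `ηL = 1`, weights `c₀L^d = c₁`, period `m`, background `U` (mutually adjoint transporters, `U(b) ∈ U1`, `‖U(b) − 1‖ ≤ αη`), every
`0 ≤ α ≤ α₁`, every positivity witness `hpos′` and every coarse `ψ`: `κ·‖ψ‖² ≤ re⟪ψ, Q̃′(U)G′(U)²Q̃′(U)†ψ⟫`.
[cite: Balaban1985BackgroundPropagators, Thm 3.11 p.416, (3.24)–(3.25) p.394, (3.35) p.396; Balaban1984PropagatorsII, (2.74)–(2.77) p.236] -/
theorem exists_qggq_coercive_window_scaled :
    ∃ α₁ κ : ℝ, 0 < α₁ ∧ 0 < κ ∧ ∀ (L : ℕ) [NeZero L], 3 ≤ L → ∀ (η : ℝ), η * (L : ℝ) = 1 →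
      ∀ (c₀ c₁ : ℝ) [Fact (0 < c₀)] [Fact (0 < c₁)], c₀ * (L : ℝ) ^ d = c₁ →
      ∀ (m : Fin d → ℕ) [∀ i, NeZero (fineP L m i)] (U : Bond d (fineP L m) → 𝔸ˣ),
        (∀ (b : Bond d (fineP L m)) (v u : W), ⟪adTransportW φ U b v, u⟫_ℂ = ⟪v, adTransportW φ (fun b => (U b)⁻¹) b u⟫_ℂ) →
      ∀ (α : ℝ), 0 ≤ α → α ≤ α₁ → (∀ b, U b ∈ U1 𝔸) → (∀ b, ‖(U b : 𝔸) - 1‖ ≤ α * η) →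
      ∀ (hpos' : ∀ x : SiteL2K ℂ d (fineP L m) c₀ W, x ≠ 0 → 0 < RCLike.re ⟪x, laplacePrimeA L m φ η U a' (c₁ := c₁) x⟫_ℂ)
        (ψ : SiteL2K ℂ d m c₁ W),
        κ * ‖ψ‖ ^ 2 ≤
          RCLike.re ⟪ψ, (((WL2.linearEquiv ℂ ℂ (fun _ : TSite d m => c₁)).symm.toLinearMap ∘ₗ QprimeW L m φ U (c₀ := c₀)) ∘ₗ
            GpOfU L m φ η U a' (c₁ := c₁) hpos' ∘ₗ GpOfU L m φ η U a' (c₁ := c₁) hpos' ∘ₗ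
            LinearMap.adjoint ((WL2.linearEquiv ℂ ℂ (fun _ : TSite d m => c₁)).symm.toLinearMap ∘ₗ QprimeW L m φ U (c₀ := c₀))) ψ⟫_ℂ := by
  obtain ⟨c, hc0, hcdef⟩ : ∃ c : ℝ, 0 ≤ c ∧ c = (d : ℝ) * (2 * Mφ * Mφ') := ⟨_, by positivity, rfl⟩
  have hX1 : (4 / 27 : ℝ) ^ d ≤ 1 := pow_le_one₀ (by norm_num) (by norm_num)
  refine ⟨min 1 ((4 / 27 : ℝ) ^ d / (4 * (c + 1))),
    1 / (36 * ((32 * (d : ℝ) + 2 * (d : ℝ) * (2 * Mφ * Mφ') ^ 2) * (729 / 16) ^ d + 9 * a' / 4) ^ 2),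
    lt_min one_pos (by positivity), by positivity, ?_⟩
  intro L _ hL3 η hηL c₀ c₁ _ _ hw m _ U hRS α hα0 hαle hUb hUε hpos' ψ
  have hα1 : α ≤ 1 := hαle.trans (min_le_left _ _)
  have hαc : α * (4 * (c + 1)) ≤ (4 / 27 : ℝ) ^ d := (le_div_iff₀ (by positivity)).1 (hαle.trans (min_le_right _ _))
  have hy0 : 0 ≤ c * α := mul_nonneg hc0 hα0
  have hcα : c * α ≤ (c + 1) * α := mul_le_mul_of_nonneg_right (by linarith) hα0
  have hy1 : c * α ≤ 1 := by linarith [hcα, hαc, hX1]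
  have hwin : Real.exp ((d : ℝ) * (2 * Mφ * Mφ') * α) - 1 ≤ (4 / 27 : ℝ) ^ d / 2 := by
    rw [show (d : ℝ) * (2 * Mφ * Mφ') * α = c * α by rw [hcdef]]
    calc Real.exp (c * α) - 1 ≤ 2 * (c * α) := exp_sub_one_le_two_mul hy0 hy1
      _ ≤ (4 / 27 : ℝ) ^ d / 2 := by linarith [hcα, hαc]
  exact qggq_coercive_window_scaled L m φ c₀ η c₁ hL3 ha' hMφ hMφ' hφ hφ' U hUb hα0 hα1 hUε hRS hpos' hηL hw hwin ψ

end Exists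

end Literature.MathematicalPhysics.QuantumFieldTheory.Balaban1983to89.B9Eq365QGGQLowerVariationalWindowUniform

end
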